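import Summits.Ventures.PercRepro.S1CoreCapFinal
import Summits.Ventures.PercRepro.S1CoreCapSixCases

/-!
# PercRepro — THE `s₄` TABLE WITH `Q*(6) = 16`, UNCONDITIONAL (p1, gen 25)

With `Q*(6) = 16` a kernel theorem (`FourCap.fourCapSpec_six`, `S1CoreCapSixCases`) the spec instances `j ≤ 6` are
all theorems (`fourCapSpec_qStar_le_six_unconditional`), so on the e-free core of nullity `6` the number of
4-circuits through a point is `≤ 16` (`ncard_fourCircuitsThrough_le_sixteen`) and `s₄ ≤ 45` (the cap sum
`1 + 4 + 5 + 8 + 11 + 16`, `ncard_fourCircuits_le_forty_five_unconditional`, from `49`). The averaging recursion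
of `S1CoreCapAvg` then gives `s₄ ≤ 67 / 96 / 134` at nullity `7 / 8 / 9` (from `73 / 105 / 147`) and in general
`s₄ ≤ avgBoundSix k` at nullity `k + 6`, `avgBoundSix 0 = 45`, `avgBoundSix (k + 1) = ⌊(k + 12) · avgBoundSix k /
(k + 8)⌋` (`ncard_fourCircuits_le_avgBoundSix`). No `FourCapSpec` hypothesis anywhere.
`proofs/P1-S4-CAPBRIDGE.md` §17. Axioms: standard.
-/

open scoped Matroid

namespace PercRepro

namespace S1

open Set

open FourCap

variable {α : Type}

/-- The instances `j ≤ 6` of the spec are all kernel theorems. -/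
theorem fourCapSpec_qStar_le_six_unconditional : ∀ j ≤ 6, FourCapSpec capPaper j (qStar j) :=
  fourCapSpec_qStar_le_six_of_five_six fourCapSpec_five fourCapSpec_six

/-- **At most `16` 4-circuits through any point of an e-free core of nullity `6`** (the bridge with `Q*(6) = 16`). -/
theorem ncard_fourCircuitsThrough_le_sixteen (M : Matroid α) [M.Finite]
    (hfree : ∀ e ∈ M.E, ∃ A ⊆ M.E \ {e}, e ∉ M.closure A ∧ e ∉ M.closure ((M.E \ {e}) \ A))
    (hd : M.E.encard = M.eRank + 6) {e : α} (he : e ∈ M.E) :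
    {C : Set α | M.IsCircuit C ∧ C.ncard = 4 ∧ e ∈ C}.ncard ≤ 16 :=
  ncard_fourCircuitsThrough_le_of_fourCapSpec M hfree hd he fourCapSpec_six

/-- **`s₄ ≤ 45` on every e-free core of nullity `6`**, unconditionally (from `49`). -/
theorem ncard_fourCircuits_le_forty_five_unconditional (M : Matroid α) [M.Finite]
    (hfree : ∀ e ∈ M.E, ∃ A ⊆ M.E \ {e}, e ∉ M.closure A ∧ e ∉ M.closure ((M.E \ {e}) \ A))
    (hd : M.E.encard = M.eRank + 6) : {C : Set α | M.IsCircuit C ∧ C.ncard = 4}.ncard ≤ 45 :=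
  ncard_fourCircuits_le_forty_five M hfree hd fourCapSpec_qStar_le_six_unconditional

/-- **The averaging table from `45`**: `avgBoundSix k` bounds `s₄` at nullity `k + 6` — `45` at `k = 0`, then
`⌊(k + 12) · avgBoundSix k / (k + 8)⌋`: `45, 67, 96, 134, 182, 242, 316, …`. -/
def avgBoundSix : ℕ → ℕ
  | 0 => 45
  | k + 1 => (k + 12) * avgBoundSix k / (k + 8)

/-- **`s₄ ≤ avgBoundSix k` on every e-free core of nullity `k + 6`**, unconditionally (induction on `k` with the
averaging recursion of `S1CoreCapAvg`). -/
theorem ncard_fourCircuits_le_avgBoundSix (k : ℕ) : ∀ (M : Matroid α) [M.Finite],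
    (∀ e ∈ M.E, ∃ A ⊆ M.E \ {e}, e ∉ M.closure A ∧ e ∉ M.closure ((M.E \ {e}) \ A)) →
    M.E.encard = M.eRank + (k + 6) → {C : Set α | M.IsCircuit C ∧ C.ncard = 4}.ncard ≤ avgBoundSix k := by
  induction k with
  | zero =>
    intro M _ hfree hd
    exact ncard_fourCircuits_le_forty_five_unconditional M hfree hd
  | succ k ih =>
    intro M _ hfree hd
    have hd' : M.E.encard = M.eRank + ((k + 6) + 1) := by
      rw [hd]; congr 1
    have h := ncard_fourCircuits_sub_div_le M hfree (d := k + 6) hd' (by omega)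
      (fun M' _ hfree' hd'' => ih M' hfree' hd'')
    have h' := le_mul_div_of_sub_div_le (m := k + 6 + 6) (by omega) h
    simp only [avgBoundSix]
    have e1 : k + 6 + 6 = k + 12 := by omega
    have e2 : k + 6 + 6 - 4 = k + 8 := by omega
    rw [e1, e2] at h'
    exact h'

/-- The first values of the table from `45`. -/
theorem avgBoundSix_values : avgBoundSix 1 = 67 ∧ avgBoundSix 2 = 96 ∧ avgBoundSix 3 = 134 ∧
    avgBoundSix 4 = 182 ∧ avgBoundSix 5 = 242 ∧ avgBoundSix 6 = 316 := by decide

/-- **`s₄ ≤ 67` on every e-free core of nullity `7`**, unconditionally (from `73`). -/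
theorem ncard_fourCircuits_le_sixty_seven_unconditional (M : Matroid α) [M.Finite]
    (hfree : ∀ e ∈ M.E, ∃ A ⊆ M.E \ {e}, e ∉ M.closure A ∧ e ∉ M.closure ((M.E \ {e}) \ A))
    (hd : M.E.encard = M.eRank + 7) : {C : Set α | M.IsCircuit C ∧ C.ncard = 4}.ncard ≤ 67 := by
  have := ncard_fourCircuits_le_avgBoundSix 1 M hfree hd
  rwa [avgBoundSix_values.1] at this

/-- **`s₄ ≤ 96` on every e-free core of nullity `8`**, unconditionally (from `105`). -/
theorem ncard_fourCircuits_le_ninety_six_unconditional (M : Matroid α) [M.Finite]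
    (hfree : ∀ e ∈ M.E, ∃ A ⊆ M.E \ {e}, e ∉ M.closure A ∧ e ∉ M.closure ((M.E \ {e}) \ A))
    (hd : M.E.encard = M.eRank + 8) : {C : Set α | M.IsCircuit C ∧ C.ncard = 4}.ncard ≤ 96 := by
  have := ncard_fourCircuits_le_avgBoundSix 2 M hfree hd
  rwa [avgBoundSix_values.2.1] at this

/-- **`s₄ ≤ 134` on every e-free core of nullity `9`**, unconditionally (from `147`). -/
theorem ncard_fourCircuits_le_one_hundred_thirty_four_unconditional (M : Matroid α) [M.Finite]
    (hfree : ∀ e ∈ M.E, ∃ A ⊆ M.E \ {e}, e ∉ M.closure A ∧ e ∉ M.closure ((M.E \ {e}) \ A))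
    (hd : M.E.encard = M.eRank + 9) : {C : Set α | M.IsCircuit C ∧ C.ncard = 4}.ncard ≤ 134 := by
  have := ncard_fourCircuits_le_avgBoundSix 3 M hfree hd
  rwa [avgBoundSix_values.2.2.1] at this

end S1

end PercRepro
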